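import Summits.QuantumFields.BalabanUV.Beta.KernelWardLevels
import Summits.QuantumFields.BalabanUV.Beta.WilsonDivergenceContact

/-!
# `BalabanUV.Beta.KernelWardLevelsWilson` — binder row D1, the WARD binder hW: an1's level-by-level root `KernelWardLevels` with the
# WILSON WARD LAW PLUGGED (item (W-LS0-E), `WilsonDivergenceContact.divV_wilsonA_eq_conjV`, constant `cE' = 1/2` decided by the kernel)

HONEST FRAMING (cell charter, verbatim): «discharging `BetaPertH` makes Bałaban's UV stability UNCONDITIONAL — a real constructive-QFT
result; it is NOT the continuum limit and NOT the Clay problem.»  DERIVED cell bookkeeping (pub-balaban β sub-cell, D1 formalisation swarm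
seat `b2b-balaban-beta-d1-formalise-leaf-05`, gen 2; sequel of its (W-LS0-E) modules `WilsonJetDivergence` / `WilsonStencilDivergence` /
`WilsonDivergenceContact` into an1-g26's `KernelWardLevels` (D1-hW-END0)); every declaration is [folklore] kernel algebra over objects ALREADY in
the tree, cited BY NAME; no statement of Bałaban's papers is typed, no `[cite:]` tag, no `def … : Prop`; it instantiates NO binder of the
β-function wall by itself.  NOT `BetaPertH`, NOT continuum, NOT Clay.
HONEST DEPENDENCY (cell records, verbatim): «continuum YM on T⁴ ⇐ BetaPertH ∧ nine spine estimates (0/9 proved); BetaPertH ⇐ (D1) ∧ (D4) ∧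
CAP+tail; G-an2-4 gates asym, D1 and NE2/3/4.»
ABSOLUTE RULE (cell charter, verbatim): «No internally-minted statement may enter as a cited fact. Every hypothesis is either kernel-proved in
this package or a verbatim quotation of a PUBLISHED theorem with page reference. The manuscript(s) under audit are NOT citable for their own
disputed steps — they are the thing under adjudication; programme-internal (2001/route/tribunal) claims are never citable.»

WHAT IS HERE.  `KernelWardLevels` (an1-g26, p210559) assembles the hW root of the centred native spine `JsBalBmNAtOf` BY NAME, level by level,
keeping as HYPOTHESES at level `0`: (i) the Wilson Ward divergence law `hEw : ∀ u, divV (wilsonA 3) u = cE' • conjV (ffK (bhKAt 3 ρ_c Lc)) (diagK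
(legInd ρ_c u))` with an unknown constant `cE'`, (ii) the scalar lock `cE·cE'·Lc⁴ = −cVH`, (iii) the W-side.  `WilsonDivergenceContact.divV_wilsonA_eq_conjV`
(leaf-05, p210394) PROVES (i) for every `d`, root and window with **`cE' = 1/2`**.  Plugging it:
* `wardTransversal_flipK_TbalOf_JsBalBmNAtOf_ctrC_zero` — LEVEL ZERO of hW from the hR NORMALISATION HYPERPLANE `2·cVH = −cE·Lc⁴` alone (the
  same hyperplane on which an2's `SpineRootedBmNAssembly.…_ctrC_wilson` discharges hR's (L2); `S0NAtReflection.S0NAt_bref_iff`) plus the W-side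
  (iii) — NO first-order Ward law remains a hypothesis at level `0`;
* `wardTransversal_flipK_TbalOf_JsBalBmNAtOf_ctrC_zero_two` — the same at the units fold `(cE, cVH) = (2, −Lc⁴)`: only the W-side remains;
* `wardTransversal_flipK_TbalOf_JsBalBmNAtOf_ctrC_of_e3Ward` — EVERY LEVEL: an1's `…_of_wardLaws` with (i) discharged; remaining hypotheses are
  the value-function cubic Ward laws `he3` at the levels `j ≥ 1` with their locks (statement-level; the row owner's (L3-D) re-typing decides their
  final shape — see `KernelWardLevels`' STATUS paragraph), the hyperplane, and the W-side.
hW is ONE of four binders {hW, hR, D1Tel, D1Rep} of row D1; 0 wall binders are instantiated here; «D1 DISCHARGE NO DATE» unchanged.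
-/

noncomputable section

open Finset
open scoped BigOperators
open Literature.MathematicalPhysics.QuantumFieldTheory.Balaban1983to89
open Literature.MathematicalPhysics.QuantumFieldTheory.Balaban1983to89.Beta
open ExpKernelCalculus (MKer comp tadpole VertexFamily₂ shiftK)
open PolarizationSign (WardTransversal)
open KernelWard (divV divW)
open StepJetData (wilsonA)
open AffineAveraging (box toSite)
open AveragingContoursRooted (ctrOff ctrOff_mem_box)
open OneStepResolventKernel (Fib)
open OneStepKernelFamily (KInvStep vertexOfK TbalOf flipK)
open BalabanStepJetsSucc (wE wVH)
open Summit.QuantumFields.BalabanUV.Beta.TameKernelCalculus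
open Summit.QuantumFields.BalabanUV.Beta.ChartConjugation (conjV conjW)
open Summit.QuantumFields.BalabanUV.Beta.AxialDressingRooted (coDressKBmAt axEc)
open Summit.QuantumFields.BalabanUV.Beta.SpineRooted (S0NAt SstepNAt e3NAtOf JsBal0NAtOf JsBalBmNAtOf)
open Summit.QuantumFields.BalabanUV.Beta.BorderedHessian (bhKAt bhKStepAt stepScale diagK)
open Summit.QuantumFields.BalabanUV.Beta.AveragingWardRootedStencils (legInd)
open Summit.QuantumFields.BalabanUV.Beta.WardLocusStencils (ffK)
open Summit.QuantumFields.BalabanUV.Beta.KernelWardLevels (xiAt wardTransversal_flipK_TbalOf_JsBalBmNAtOf_ctrC_zero_of_wilsonWard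
  wardTransversal_flipK_TbalOf_JsBalBmNAtOf_ctrC_of_wardLaws)
open Summit.QuantumFields.BalabanUV.Beta.WilsonDivergenceContact (divV_wilsonA_eq_conjV)

namespace Summit.QuantumFields.BalabanUV.Beta.KernelWardLevelsWilson

/-! ## §1 Level zero: only the normalisation hyperplane and the W-side remain -/

section Zero
variable {Lc : ℕ} [NeZero Lc]

omit [NeZero Lc] in
/-- [folklore] the hR normalisation hyperplane `2·cVH = −cE·Lc⁴` IS the level-zero lock of `KernelWardLevels` at the kernel-decided Wilson constant
`cE' = 1/2`. -/
theorem lock_zero_of_hyperplane {cE cVH : ℝ} (hn : 2 * cVH = -(cE * (Lc : ℝ) ^ (3 + 1))) :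
    cE * (1 / 2) * (Lc : ℝ) ^ (3 + 1) = -cVH := by
  linear_combination (1 / 2 : ℝ) * hn

/-- **LEVEL ZERO OF hW — THE WILSON WARD LAW DISCHARGED.**  Member `0` of the wall binder hW for the centred native spine `JsBalBmNAtOf` follows
from the hR normalisation hyperplane `hn : 2·cVH = −cE·Lc⁴` and the W-side ALONE: an1's `wardTransversal_flipK_TbalOf_JsBalBmNAtOf_ctrC_zero_of_wilsonWard`
with `hEw := WilsonDivergenceContact.divV_wilsonA_eq_conjV` (`cE' = 1/2`).  The generator of the block rotation is DETERMINED: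
`X₀ y = diagK ((cE·½/Lc⁴) • Σ_{v ∈ box} legInd ρ_c (Lc•y + v))`.  [folklore] -/
theorem wardTransversal_flipK_TbalOf_JsBalBmNAtOf_ctrC_zero (hLc : Odd Lc) (cE cVH cΛ : ℝ)
    (W : ℕ → Fin 4 → (Fin 4 → ℤ) → Fin 4 → (Fin 4 → ℤ) → MKer 4 (Fib 3)) (Cw δw : ℕ → ℝ) (hδw : ∀ j, 0 < δw j)
    (hW : ∀ j, VertexFamily₂ (W j) Lc (Cw j) (δw j))
    (hWt : ∀ (j : ℕ) (μ : Fin 4) (y : Fin 4 → ℤ) (ν : Fin 4) (y' t : Fin 4 → ℤ),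
      W j μ (y + t) ν (y' + t) = shiftK (-((Lc : ℤ) • t)) (W j μ y ν y'))
    (hn : 2 * cVH = -(cE * (Lc : ℝ) ^ (3 + 1)))
    (X₂ Nr : (Fin 4 → ℤ) → Fin 4 → (Fin 4 → ℤ) → MKer 4 (Fib 3)) (hX₂ : ∀ y ν y', Loc (X₂ y ν y')) (hNr : ∀ y ν y', Loc (Nr y ν y'))
    (hEX₂ : ∀ y ν y', comp (axEc (toSite (ctrOff 4 Lc)) Lc) (X₂ y ν y') = comp (X₂ y ν y') (axEc (toSite (ctrOff 4 Lc)) Lc))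
    (hWd : ∀ (y : Fin 4 → ℤ) (ν : Fin 4) (y' : Fin 4 → ℤ),
      divW (W 0) y ν y' =
        conjW (bhKAt 3 (toSite (ctrOff 4 Lc)) Lc) 0
          (vertexOfK (coDressKBmAt (toSite (ctrOff 4 Lc)) Lc (KInvStep (d := 3) Lc 0)) Lc (S0NAt 3 Lc (toSite (ctrOff 4 Lc)) cE cVH cΛ) ν y')
          (diagK ((cE * (1 / 2) / (Lc : ℝ) ^ (3 + 1)) • ∑ v ∈ box 4 Lc, legInd (toSite (ctrOff 4 Lc)) ((Lc : ℤ) • y + toSite v))) 0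
          (X₂ y ν y')
        + Nr y ν y')
    (hN0 : ∀ y ν y', tadpole (coDressKBmAt (toSite (ctrOff 4 Lc)) Lc (KInvStep (d := 3) Lc 0)) (Nr y ν y') = 0) :
    WardTransversal (flipK (TbalOf Lc (JsBalBmNAtOf (d := 3) hLc.pos (ctrOff_mem_box hLc.pos) cE cVH cΛ W Cw δw hδw hW) 0)) :=
  wardTransversal_flipK_TbalOf_JsBalBmNAtOf_ctrC_zero_of_wilsonWard hLc cE cVH cΛ (1 / 2) W Cw δw hδw hW hWt
    (fun u => divV_wilsonA_eq_conjV (toSite (ctrOff 4 Lc)) Lc u) (lock_zero_of_hyperplane hn) X₂ Nr hX₂ hNr hEX₂ hWd hN0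

/-- **LEVEL ZERO OF hW AT THE UNITS FOLD `(cE, cVH) = (2, −Lc⁴)`** (R45 / an2 l.4657 / an1-g24 AUDIT l.4697; the fold on which hR's (L1)+(L2) are
discharged, `SpineRootedBmNAssembly.…_ctrC_assembled_two`): only the W-side remains a hypothesis; the block rotation generator is
`X₀ y = diagK (Lc⁻⁴ • Σ_{v ∈ box} legInd ρ_c (Lc•y + v))` (coefficient written `2·½/Lc⁴`).  [folklore] -/
theorem wardTransversal_flipK_TbalOf_JsBalBmNAtOf_ctrC_zero_two (hLc : Odd Lc) (cΛ : ℝ)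
    (W : ℕ → Fin 4 → (Fin 4 → ℤ) → Fin 4 → (Fin 4 → ℤ) → MKer 4 (Fib 3)) (Cw δw : ℕ → ℝ) (hδw : ∀ j, 0 < δw j)
    (hW : ∀ j, VertexFamily₂ (W j) Lc (Cw j) (δw j))
    (hWt : ∀ (j : ℕ) (μ : Fin 4) (y : Fin 4 → ℤ) (ν : Fin 4) (y' t : Fin 4 → ℤ),
      W j μ (y + t) ν (y' + t) = shiftK (-((Lc : ℤ) • t)) (W j μ y ν y'))
    (X₂ Nr : (Fin 4 → ℤ) → Fin 4 → (Fin 4 → ℤ) → MKer 4 (Fib 3)) (hX₂ : ∀ y ν y', Loc (X₂ y ν y')) (hNr : ∀ y ν y', Loc (Nr y ν y'))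
    (hEX₂ : ∀ y ν y', comp (axEc (toSite (ctrOff 4 Lc)) Lc) (X₂ y ν y') = comp (X₂ y ν y') (axEc (toSite (ctrOff 4 Lc)) Lc))
    (hWd : ∀ (y : Fin 4 → ℤ) (ν : Fin 4) (y' : Fin 4 → ℤ),
      divW (W 0) y ν y' =
        conjW (bhKAt 3 (toSite (ctrOff 4 Lc)) Lc) 0
          (vertexOfK (coDressKBmAt (toSite (ctrOff 4 Lc)) Lc (KInvStep (d := 3) Lc 0)) Lc
            (S0NAt 3 Lc (toSite (ctrOff 4 Lc)) 2 (-((Lc : ℝ) ^ (3 + 1))) cΛ) ν y')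
          (diagK (((2 : ℝ) * (1 / 2) / (Lc : ℝ) ^ (3 + 1)) • ∑ v ∈ box 4 Lc, legInd (toSite (ctrOff 4 Lc)) ((Lc : ℤ) • y + toSite v))) 0
          (X₂ y ν y')
        + Nr y ν y')
    (hN0 : ∀ y ν y', tadpole (coDressKBmAt (toSite (ctrOff 4 Lc)) Lc (KInvStep (d := 3) Lc 0)) (Nr y ν y') = 0) :
    WardTransversal (flipK (TbalOf Lc
      (JsBalBmNAtOf (d := 3) hLc.pos (ctrOff_mem_box hLc.pos) 2 (-((Lc : ℝ) ^ (3 + 1))) cΛ W Cw δw hδw hW) 0)) :=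
  wardTransversal_flipK_TbalOf_JsBalBmNAtOf_ctrC_zero hLc 2 (-((Lc : ℝ) ^ (3 + 1))) cΛ W Cw δw hδw hW hWt (by ring) X₂ Nr hX₂ hNr hEX₂
    hWd hN0

end Zero

/-! ## §2 Every level: the Wilson law discharged; the value-function cubic laws, the locks and the W-side remain -/

section All
variable {Lc : ℕ} [NeZero Lc]

/-- **hW AT EVERY LEVEL — THE WILSON WARD LAW DISCHARGED.**  an1's `KernelWardLevels.wardTransversal_flipK_TbalOf_JsBalBmNAtOf_ctrC_of_wardLaws`
with `hEw := WilsonDivergenceContact.divV_wilsonA_eq_conjV` (`cE' = 1/2`) and the level-zero lock replaced by the normalisation hyperplane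
`2·cVH = −cE·Lc⁴`.  REMAINING HYPOTHESES: the value-function cubic Ward laws `he3` at the levels `j ≥ 1` with their constants `c3` and locks
(statement-level — the Ward twins of hR's (L3); their fillable shape is the row owner's (L3-D) re-typing, `KernelWardLevels` STATUS paragraph),
and the W-side (X₂, Nr, hWd, hN0) at every level with the determined generators `diagK (xiAt Lc cE ½ c3 j • Σ legInd …)`.  [folklore] -/
theorem wardTransversal_flipK_TbalOf_JsBalBmNAtOf_ctrC_of_e3Ward (hLc : Odd Lc) (cE cVH cΛ : ℝ) (c3 : ℕ → ℝ)
    (W : ℕ → Fin 4 → (Fin 4 → ℤ) → Fin 4 → (Fin 4 → ℤ) → MKer 4 (Fib 3)) (Cw δw : ℕ → ℝ) (hδw : ∀ j, 0 < δw j)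
    (hW : ∀ j, VertexFamily₂ (W j) Lc (Cw j) (δw j))
    (hWt : ∀ (j : ℕ) (μ : Fin 4) (y : Fin 4 → ℤ) (ν : Fin 4) (y' t : Fin 4 → ℤ),
      W j μ (y + t) ν (y' + t) = shiftK (-((Lc : ℤ) • t)) (W j μ y ν y'))
    (he3 : ∀ (j : ℕ) (u : Fin 4 → ℤ), divV (e3NAtOf 3 Lc (toSite (ctrOff 4 Lc)) cE cVH cΛ (j + 1)) u =
      c3 (j + 1) • conjV (ffK (bhKStepAt 3 (toSite (ctrOff 4 Lc)) Lc (j + 1))) (diagK (legInd (toSite (ctrOff 4 Lc)) u)))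
    (hn : 2 * cVH = -(cE * (Lc : ℝ) ^ (3 + 1)))
    (hlock : ∀ j : ℕ, cE * wE 3 Lc (j + 1) * c3 (j + 1) * (stepScale 3 Lc (j + 1) * (Lc : ℝ) ^ (3 + 1)) = -(cVH * wVH 3 Lc (j + 1)))
    (X₂ Nr : ℕ → (Fin 4 → ℤ) → Fin 4 → (Fin 4 → ℤ) → MKer 4 (Fib 3)) (hX₂ : ∀ j y ν y', Loc (X₂ j y ν y'))
    (hNr : ∀ j y ν y', Loc (Nr j y ν y'))
    (hEX₂ : ∀ j y ν y', comp (axEc (toSite (ctrOff 4 Lc)) Lc) (X₂ j y ν y') = comp (X₂ j y ν y') (axEc (toSite (ctrOff 4 Lc)) Lc))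
    (hWd : ∀ (j : ℕ) (y : Fin 4 → ℤ) (ν : Fin 4) (y' : Fin 4 → ℤ),
      divW (W j) y ν y' =
        conjW (bhKStepAt 3 (toSite (ctrOff 4 Lc)) Lc j) 0
          (vertexOfK (coDressKBmAt (toSite (ctrOff 4 Lc)) Lc (KInvStep (d := 3) Lc j)) Lc
            (JsBal0NAtOf (d := 3) hLc.pos (ctrOff_mem_box hLc.pos) cE cVH cΛ W Cw δw hδw hW j).S ν y')
          (diagK (xiAt Lc cE (1 / 2) c3 j • ∑ v ∈ box 4 Lc, legInd (toSite (ctrOff 4 Lc)) ((Lc : ℤ) • y + toSite v))) 0 (X₂ j y ν y')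
        + Nr j y ν y')
    (hN0 : ∀ j y ν y', tadpole (coDressKBmAt (toSite (ctrOff 4 Lc)) Lc (KInvStep (d := 3) Lc j)) (Nr j y ν y') = 0) :
    ∀ j : ℕ, WardTransversal
      (flipK (TbalOf Lc (JsBalBmNAtOf (d := 3) hLc.pos (ctrOff_mem_box hLc.pos) cE cVH cΛ W Cw δw hδw hW) j)) :=
  wardTransversal_flipK_TbalOf_JsBalBmNAtOf_ctrC_of_wardLaws hLc cE cVH cΛ (1 / 2) c3 W Cw δw hδw hW hWt
    (fun u => divV_wilsonA_eq_conjV (toSite (ctrOff 4 Lc)) Lc u) he3 (lock_zero_of_hyperplane hn) hlock X₂ Nr hX₂ hNr hEX₂ hWd hN0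

end All

end Summit.QuantumFields.BalabanUV.Beta.KernelWardLevelsWilson

end
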